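import Literature.Probability.Percolation.BKFinitary
import Literature.Probability.Percolation.TreeGraphBound
import HarnessLib

/-!
# The depth-first exploration of an open cluster stopped at two targets (Gladkov 2024, §6.2)

Source: N. Gladkov, *Percolation Inequalities and Decision Trees*, arXiv:2408.08457v2 (2024)
[Gladkov2024], §6 (Algorithm 2 "DFS Decision Tree")
and §6.2 (proof of Theorem 6.2): "Let tree `T` perform a DFS starting with the vertex `a` and
put the edges it meets in `S` … After reaching `b` or `c`, the tree `T` stops … Backtracking the
DFS order leaves us with a path `P` from `a` to either `b` or `c`. Note that `T` queries all the
edges of the path `P` and puts them to `S`. Let `Q` be the set of vertices visited by the DFS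
that are not in `P` … the DFS queried all edges from `Q` before backtracking and so all of these
edges, including those closed in `C₁`, belong to `S`."

This file formalises that exploration as a deterministic, adaptive edge-revealing process
(every queried edge is revealed; its decision tree in the sense of `DecisionTreeBK.lean` is
built in `GladkovThreePointBoundProofs.lean`), for configurations `K ⊆ D` of open edges among
a finite set `D ⊆ Sym2 V` of edges, and proves the structural facts the proof of Thm. 6.2
uses.

* `St` — states (DFS stack with the current vertex on top and the root `a` at the bottom,
  visited vertices, revealed edges, `done` flag); `pending`, `settle` (backtracking: pop
  saturated vertices), `next` (the edge queried next, `none` = stop), `update`, `init`;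
  `final` — the state reached on a configuration (fuel `n`); `final_congr` — it depends on the
  configuration only through the revealed edges.
* `Inv` — the invariant (stack is a duplicate-free chain of open revealed edges ending at `a`;
  visited vertices off the stack are saturated; open revealed edges have visited endpoints;
  the targets `b, c` are not visited before stopping; after stopping the top of the stack is the
  target reached and the other target is unvisited); `inv_final`.
* `next_final_eq_none` — with fuel `#D + 1` the exploration halts; `done_of_reachable` — if `a`
  is joined to `b` by `K`-open edges (`K ⊆ D`) the exploration stops at a target
  (`abc ⊆ R_b ∪ R_c` in the paper); `reachable_of_done` (`R_t ⊆ {a ↔ t}`);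
  **`exists_entry`** — the key geometric fact of §6.2: for any configuration `ω ⊆ D` agreeing
  with `K` on the revealed edges, an `ω`-open path from an unvisited vertex to a visited one
  has an initial segment of UNREVEALED open edges ending ON THE STACK (the path `P`).

Not here: the probabilistic estimates (they are in `GladkovThreePointBoundProofs.lean`).
-/

noncomputable section

namespace Literature.Probability.Percolation

namespace Gladkov

open Finset

variable {V : Type*} [DecidableEq V]

/-! ### States and one step of the exploration -/

/-- A state of the exploration: the DFS stack (current vertex first, root last), the visited
vertices, the revealed edges, and whether a target has been reached. [cite: Gladkov2024, §6 Algorithm 2] -/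
structure St (V : Type*) where
  /-- the DFS stack, current vertex on top, root at the bottom -/
  stack : List V
  /-- the visited vertices -/
  vis : Finset V
  /-- the revealed (queried) edges -/
  rev : Finset (Sym2 V)
  /-- whether a target has been reached -/
  done : Bool

section Defs

variable (D : Finset (Sym2 V)) (b c : V)

/-- The unrevealed edges of `D` at the vertex `v`. [cite: Gladkov2024, §6 Algorithm 2] -/
def pending (rev : Finset (Sym2 V)) (v : V) : Finset (Sym2 V) :=
  D.filter fun e => e ∉ rev ∧ v ∈ e

/-- Backtracking: pop the saturated vertices (no unrevealed edge) off the top of the stack.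
[cite: Gladkov2024, §6 Algorithm 2] -/
def settle (rev : Finset (Sym2 V)) : List V → List V
  | [] => []
  | v :: rest => if pending D rev v = ∅ then settle rev rest else v :: rest

/-- A choice of an element of a finite set, if any. [folklore] -/
def pick (s : Finset (Sym2 V)) : Option (Sym2 V) :=
  if h : s.Nonempty then some h.choose else none

/-- The edge queried next: an unrevealed edge at the current vertex (after backtracking);
`none` once a target is reached or the cluster is exhausted. [cite: Gladkov2024, §6 Algorithm 2] -/
def next (σ : St V) : Option (Sym2 V) :=
  if σ.done then none
  else
    match settle D σ.rev σ.stack with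
    | [] => none
    | v :: _ => pick (pending D σ.rev v)

/-- The other endpoint of the edge `e` seen from `v` (junk value `v` if `v ∉ e`). [folklore] -/
def otherEnd (v : V) (e : Sym2 V) : V := if h : v ∈ e then Sym2.Mem.other h else v

/-- One step: reveal the edge `e` at the current vertex `v`; if it is open and leads to a
target, push the target and stop; if it is open and leads to an unvisited vertex, push it;
otherwise stay. [cite: Gladkov2024, §6 Algorithm 2 and §6.2] -/
def update (σ : St V) (e : Sym2 V) (isOpen : Bool) : St V :=
  match settle D σ.rev σ.stack with
  | [] => ⟨σ.stack, σ.vis, insert e σ.rev, σ.done⟩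
  | v :: rest =>
      if isOpen then
        if otherEnd v e = b ∨ otherEnd v e = c then
          ⟨otherEnd v e :: v :: rest, insert (otherEnd v e) σ.vis, insert e σ.rev, true⟩
        else if otherEnd v e ∈ σ.vis then ⟨v :: rest, σ.vis, insert e σ.rev, false⟩
        else ⟨otherEnd v e :: v :: rest, insert (otherEnd v e) σ.vis, insert e σ.rev, false⟩
      else ⟨v :: rest, σ.vis, insert e σ.rev, false⟩

/-- The state reached from `σ` on the configuration `K` (open edges), with fuel `n`.
[cite: Gladkov2024, §6.2] -/
def final (K : Finset (Sym2 V)) : ℕ → St V → St V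
  | 0, σ => σ
  | n + 1, σ =>
      match next D σ with
      | none => σ
      | some e => final K n (update D b c σ e (decide (e ∈ K)))

/-- The initial state: stack `[a]`, `a` visited, nothing revealed. [cite: Gladkov2024, §6.2] -/
def init (a : V) : St V := ⟨[a], {a}, ∅, false⟩

end Defs

section Basic

variable {D : Finset (Sym2 V)} {b c : V}

/-- Membership in `pending`. [folklore] -/
theorem mem_pending {rev : Finset (Sym2 V)} {v : V} {e : Sym2 V} :
    e ∈ pending D rev v ↔ e ∈ D ∧ e ∉ rev ∧ v ∈ e := by
  simp [pending, Finset.mem_filter]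

/-- `pending` shrinks as edges are revealed. [folklore] -/
theorem pending_mono {rev rev' : Finset (Sym2 V)} (h : rev ⊆ rev') (v : V) :
    pending D rev' v ⊆ pending D rev v := fun e he => by
  rw [mem_pending] at he ⊢
  exact ⟨he.1, fun h' => he.2.1 (h h'), he.2.2⟩

omit [DecidableEq V] in
/-- `pick` returns an element of the set. [folklore] -/
theorem mem_of_pick_eq_some {s : Finset (Sym2 V)} {e : Sym2 V} (h : pick s = some e) : e ∈ s := by
  unfold pick at h
  split_ifs at h with hs
  rw [Option.some.injEq] at h
  exact h ▸ hs.choose_spec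

omit [DecidableEq V] in
/-- `pick` of a nonempty set is `some`. [folklore] -/
theorem pick_ne_none {s : Finset (Sym2 V)} (h : s.Nonempty) : pick s ≠ none := by
  unfold pick; rw [dif_pos h]; exact Option.some_ne_none _

/-- `settle` returns a suffix of the stack. [folklore] -/
theorem settle_suffix (rev : Finset (Sym2 V)) : ∀ L : List V, settle D rev L <:+ L
  | [] => List.suffix_refl _
  | v :: rest => by
      unfold settle
      split_ifs
      · exact (settle_suffix rev rest).trans (List.suffix_cons v rest)
      · exact List.suffix_refl _

/-- The vertex on top after `settle` is not saturated. [folklore] -/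
theorem pending_ne_empty_of_settle_eq_cons (rev : Finset (Sym2 V)) :
    ∀ {L : List V} {v : V} {rest : List V}, settle D rev L = v :: rest → pending D rev v ≠ ∅
  | [], _, _, h => by simp [settle] at h
  | w :: rest', v, rest, h => by
      unfold settle at h
      split_ifs at h with hw
      · exact pending_ne_empty_of_settle_eq_cons rev h
      · rw [List.cons.injEq] at h
        exact h.1 ▸ hw

/-- The vertices popped by `settle` are saturated. [folklore] -/
theorem pending_eq_empty_of_not_mem_settle (rev : Finset (Sym2 V)) :
    ∀ {L : List V} {x : V}, x ∈ L → x ∉ settle D rev L → pending D rev x = ∅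
  | [], _, h, _ => by simp at h
  | w :: rest, x, hx, hx' => by
      unfold settle at hx'
      split_ifs at hx' with hw
      · rcases List.mem_cons.1 hx with rfl | hx
        · exact hw
        · exact pending_eq_empty_of_not_mem_settle rev hx hx'
      · exact absurd hx hx'

/-- What `next = some e` says about the state. [folklore] -/
theorem next_eq_some {σ : St V} {e : Sym2 V} (h : next D σ = some e) :
    σ.done = false ∧ ∃ v rest, settle D σ.rev σ.stack = v :: rest ∧ e ∈ pending D σ.rev v := by
  unfold next at h
  split_ifs at h with hd
  revert h
  cases hs : settle D σ.rev σ.stack with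
  | nil => intro h; exact absurd h (by simp)
  | cons v rest =>
      intro h
      exact ⟨by simpa using hd, v, rest, rfl, mem_of_pick_eq_some h⟩

/-- What `next = none` says about the state: a target was reached, or backtracking empties the
stack. [folklore] -/
theorem next_eq_none {σ : St V} (h : next D σ = none) :
    σ.done = true ∨ settle D σ.rev σ.stack = [] := by
  unfold next at h
  split_ifs at h with hd
  · exact Or.inl hd
  · revert h
    cases hs : settle D σ.rev σ.stack with
    | nil => intro; exact Or.inr rfl
    | cons v rest =>
        intro h
        exact absurd h (pick_ne_none (Finset.nonempty_iff_ne_empty.2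
          (pending_ne_empty_of_settle_eq_cons σ.rev hs)))

/-- `otherEnd` is the other endpoint. [folklore] -/
theorem mk_otherEnd {v : V} {e : Sym2 V} (h : v ∈ e) : s(v, otherEnd v e) = e := by
  unfold otherEnd; rw [dif_pos h]; exact Sym2.other_spec h

/-- `update` reveals exactly the queried edge. [folklore] -/
theorem rev_update (σ : St V) (e : Sym2 V) (o : Bool) :
    (update D b c σ e o).rev = insert e σ.rev := by
  unfold update
  split
  · rfl
  · split_ifs <;> rfl

/-- The revealed set only grows along the run. [folklore] -/
theorem subset_rev_final (K : Finset (Sym2 V)) :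
    ∀ (n : ℕ) (σ : St V), σ.rev ⊆ (final D b c K n σ).rev
  | 0, _ => subset_rfl
  | n + 1, σ => by
      simp only [final]
      cases hn : next D σ with
      | none => exact subset_rfl
      | some e =>
          refine subset_trans ?_ (subset_rev_final K n _)
          rw [rev_update]
          exact Finset.subset_insert e σ.rev

/-- The final state only depends on the configuration through the revealed edges: if `K'`
agrees with `K` on `(final K).rev` then `final K' = final K`. [cite: Gladkov2024, §6.2] -/
theorem final_congr {K K' : Finset (Sym2 V)} :
    ∀ (n : ℕ) (σ : St V), (∀ e ∈ (final D b c K n σ).rev, (e ∈ K ↔ e ∈ K')) →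
      final D b c K' n σ = final D b c K n σ
  | 0, _, _ => rfl
  | n + 1, σ, h => by
      simp only [final] at h ⊢
      cases hn : next D σ with
      | none => rfl
      | some e =>
          rw [hn] at h
          simp only at h
          have he : e ∈ (final D b c K n (update D b c σ e (decide (e ∈ K)))).rev := by
            refine subset_rev_final K n _ ?_
            rw [rev_update]
            exact Finset.mem_insert_self _ _
          have hdec : decide (e ∈ K') = decide (e ∈ K) := decide_eq_decide.2 (h e he).symm
          simp only
          rw [hdec]
          exact final_congr n _ h

end Basic

/-! ### The invariant -/

/-- The invariant of the exploration of the `K`-open cluster of `a` with targets `b, c`.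
[cite: Gladkov2024, §6.2 (the path P and the set Q)] -/
structure Inv (D : Finset (Sym2 V)) (a b c : V) (K : Finset (Sym2 V)) (σ : St V) : Prop where
  /-- the root is at the bottom of the stack -/
  last : σ.stack.getLast? = some a
  /-- the stack is duplicate-free (a path) -/
  nodup : σ.stack.Nodup
  /-- consecutive stack vertices are joined by open revealed edges -/
  chain : List.IsChain (fun u v => u ≠ v ∧ s(u, v) ∈ σ.rev ∧ s(u, v) ∈ K) σ.stack
  /-- stack vertices are visited -/
  stack_vis : ∀ v ∈ σ.stack, v ∈ σ.vis
  /-- visited vertices off the stack are saturated (the set `Q` of the paper) -/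
  saturated : ∀ v ∈ σ.vis, v ∉ σ.stack → pending D σ.rev v = ∅
  /-- open revealed edges have visited endpoints -/
  closed : ∀ e ∈ σ.rev, e ∈ K → ∀ v ∈ e, v ∈ σ.vis
  /-- before stopping, the targets are unvisited -/
  targets : σ.done = false → b ∉ σ.vis ∧ c ∉ σ.vis
  /-- after stopping, the top of the stack is the target reached, the other is unvisited -/
  tip : σ.done = true → ∃ t rest, σ.stack = t :: rest ∧ (t = b ∨ t = c) ∧
    (t = b → c ∉ σ.vis) ∧ (t = c → b ∉ σ.vis)
  /-- only edges of `D` are revealed -/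
  rev_sub : σ.rev ⊆ D

section Invariant

variable {D : Finset (Sym2 V)} {a b c : V} {K : Finset (Sym2 V)}

/-- The initial state satisfies the invariant (`a ∉ {b, c}`). [folklore] -/
theorem inv_init (hab : a ≠ b) (hac : a ≠ c) : Inv D a b c K (init a) := by
  refine ⟨rfl, List.nodup_singleton a, List.IsChain.singleton a, ?_, ?_, ?_, ?_, ?_, ?_⟩
  · intro v hv
    simp only [init, List.mem_singleton] at hv
    simp [init, hv]
  · intro v hv hv'
    simp only [init, Finset.mem_singleton] at hv
    simp [init, hv] at hv'
  · intro e he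
    simp [init] at he
  · intro
    simp only [init, Finset.mem_singleton]
    exact ⟨fun h => hab h.symm, fun h => hac h.symm⟩
  · intro h
    simp [init] at h
  · simp [init]

omit [DecidableEq V] in
/-- A nonempty suffix has the same last element. [folklore] -/
theorem getLast?_of_suffix {L L' : List V} (h : L' <:+ L) (hne : L' ≠ []) {x : V}
    (hL : L.getLast? = some x) : L'.getLast? = some x := by
  obtain ⟨pre, rfl⟩ := h
  rw [List.getLast?_append] at hL
  cases h' : L'.getLast? with
  | none => exact absurd (List.getLast?_eq_none_iff.1 h') hne
  | some y => rw [h'] at hL; simpa using hL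

/-- **The invariant is preserved by a step of the exploration.** [cite: Gladkov2024, §6.2] -/
theorem inv_update (hbc : b ≠ c) {σ : St V} (hσ : Inv D a b c K σ) {e : Sym2 V}
    (he : next D σ = some e) : Inv D a b c K (update D b c σ e (decide (e ∈ K))) := by
  obtain ⟨hdone, v, rest, hset, hev⟩ := next_eq_some he
  rw [mem_pending] at hev
  obtain ⟨heD, herev, hve⟩ := hev
  -- facts about the settled stack `v :: rest`
  have hsuf : (v :: rest) <:+ σ.stack := hset ▸ settle_suffix (D := D) σ.rev σ.stack
  have hsub : ∀ x ∈ v :: rest, x ∈ σ.stack := fun x hx => hsuf.subset hx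
  have hlast' : (v :: rest).getLast? = some a := getLast?_of_suffix hsuf (List.cons_ne_nil _ _) hσ.last
  have hnodup' : (v :: rest).Nodup := List.Nodup.sublist hsuf.sublist hσ.nodup
  have hchain' : List.IsChain (fun u w => u ≠ w ∧ s(u, w) ∈ σ.rev ∧ s(u, w) ∈ K) (v :: rest) :=
    List.IsChain.infix hσ.chain hsuf.isInfix
  have hsat' : ∀ x ∈ σ.vis, x ∉ v :: rest → pending D σ.rev x = ∅ := by
    intro x hx hx'
    by_cases hxs : x ∈ σ.stack
    · exact pending_eq_empty_of_not_mem_settle σ.rev hxs (hset ▸ hx')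
    · exact hσ.saturated x hx hxs
  have hvvis : v ∈ σ.vis := hσ.stack_vis v (hsub v (List.mem_cons_self ..))
  have htar := hσ.targets hdone
  -- monotonicity helpers for the bigger revealed set
  have chain_mono : ∀ {L : List V},
      List.IsChain (fun u w => u ≠ w ∧ s(u, w) ∈ σ.rev ∧ s(u, w) ∈ K) L →
        List.IsChain (fun u w => u ≠ w ∧ s(u, w) ∈ insert e σ.rev ∧ s(u, w) ∈ K) L :=
    fun h => List.IsChain.imp (fun u w huw => ⟨huw.1, Finset.mem_insert_of_mem huw.2.1, huw.2.2⟩) h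
  have sat_mono : ∀ x, pending D σ.rev x = ∅ → pending D (insert e σ.rev) x = ∅ := fun x hx =>
    Finset.subset_empty.1 (hx ▸ pending_mono (Finset.subset_insert e σ.rev) x)
  have hrevD : insert e σ.rev ⊆ D := Finset.insert_subset heD hσ.rev_sub
  unfold update
  rw [hset]
  simp only
  set u := otherEnd v e with hu
  have hvu : s(v, u) = e := mk_otherEnd hve
  have hmem_e : ∀ w ∈ e, w = v ∨ w = u := fun w hw => by
    rw [← hvu, Sym2.mem_iff] at hw; exact hw
  by_cases hopen : e ∈ K
  · rw [decide_eq_true hopen, if_pos rfl]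
    by_cases htgt : u = b ∨ u = c
    · -- open edge to a target: push it and stop
      rw [if_pos htgt]
      have hunot : u ∉ σ.vis := by
        rcases htgt with h | h
        · rw [h]; exact htar.1
        · rw [h]; exact htar.2
      have hust : u ∉ v :: rest := fun h => hunot (hσ.stack_vis u (hsub u h))
      refine
        { last := by rw [List.getLast?_cons_cons]; exact hlast'
          nodup := List.nodup_cons.2 ⟨hust, hnodup'⟩
          chain := List.IsChain.cons_cons ⟨fun h => hust (h ▸ List.mem_cons_self ..),
            by rw [Sym2.eq_swap, hvu]; exact Finset.mem_insert_self _ _,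
            by rw [Sym2.eq_swap, hvu]; exact hopen⟩ (chain_mono hchain')
          stack_vis := fun x hx => by
            rcases List.mem_cons.1 hx with rfl | hx
            · exact Finset.mem_insert_self _ _
            · exact Finset.mem_insert_of_mem (hσ.stack_vis x (hsub x hx))
          saturated := fun x hx hx' => by
            rw [Finset.mem_insert] at hx
            rcases hx with rfl | hx
            · exact absurd (List.mem_cons_self ..) hx'
            · exact sat_mono x (hsat' x hx fun h => hx' (List.mem_cons_of_mem _ h))
          closed := fun e' he' he'K w hw => by
            rw [Finset.mem_insert] at he'
            rcases he' with rfl | he'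
            · rcases hmem_e w hw with rfl | rfl
              · exact Finset.mem_insert_of_mem hvvis
              · exact Finset.mem_insert_self _ _
            · exact Finset.mem_insert_of_mem (hσ.closed e' he' he'K w hw)
          targets := fun h => absurd h (by simp)
          tip := fun _ => ⟨u, v :: rest, rfl, htgt, fun hub => ?_, fun huc => ?_⟩
          rev_sub := hrevD }
      · rw [hub, Finset.mem_insert]
        rintro (h | h)
        · exact hbc h.symm
        · exact htar.2 h
      · rw [huc, Finset.mem_insert]
        rintro (h | h)
        · exact hbc h
        · exact htar.1 h
    · rw [if_neg htgt]
      by_cases huvis : u ∈ σ.vis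
      · -- open edge to a visited vertex: stay
        rw [if_pos huvis]
        exact
          { last := hlast'
            nodup := hnodup'
            chain := chain_mono hchain'
            stack_vis := fun x hx => hσ.stack_vis x (hsub x hx)
            saturated := fun x hx hx' => sat_mono x (hsat' x hx hx')
            closed := fun e' he' he'K w hw => by
              rw [Finset.mem_insert] at he'
              rcases he' with rfl | he'
              · rcases hmem_e w hw with rfl | rfl
                · exact hvvis
                · exact huvis
              · exact hσ.closed e' he' he'K w hw
            targets := fun _ => htar
            tip := fun h => absurd h (by simp)
            rev_sub := hrevD }
      · -- open edge to a new vertex: push it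
        rw [if_neg huvis]
        have hust : u ∉ v :: rest := fun h => huvis (hσ.stack_vis u (hsub u h))
        have hub : u ≠ b := fun h => htgt (Or.inl h)
        have huc : u ≠ c := fun h => htgt (Or.inr h)
        exact
          { last := by rw [List.getLast?_cons_cons]; exact hlast'
            nodup := List.nodup_cons.2 ⟨hust, hnodup'⟩
            chain := List.IsChain.cons_cons ⟨fun h => hust (h ▸ List.mem_cons_self ..),
              by rw [Sym2.eq_swap, hvu]; exact Finset.mem_insert_self _ _,
              by rw [Sym2.eq_swap, hvu]; exact hopen⟩ (chain_mono hchain')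
            stack_vis := fun x hx => by
              rcases List.mem_cons.1 hx with rfl | hx
              · exact Finset.mem_insert_self _ _
              · exact Finset.mem_insert_of_mem (hσ.stack_vis x (hsub x hx))
            saturated := fun x hx hx' => by
              rw [Finset.mem_insert] at hx
              rcases hx with rfl | hx
              · exact absurd (List.mem_cons_self ..) hx'
              · exact sat_mono x (hsat' x hx fun h => hx' (List.mem_cons_of_mem _ h))
            closed := fun e' he' he'K w hw => by
              rw [Finset.mem_insert] at he'
              rcases he' with rfl | he'
              · rcases hmem_e w hw with rfl | rfl
                · exact Finset.mem_insert_of_mem hvvis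
                · exact Finset.mem_insert_self _ _
              · exact Finset.mem_insert_of_mem (hσ.closed e' he' he'K w hw)
            targets := fun _ => by
              rw [Finset.mem_insert, Finset.mem_insert]
              exact ⟨fun h => h.elim (fun h => hub h.symm) htar.1,
                fun h => h.elim (fun h => huc h.symm) htar.2⟩
            tip := fun h => absurd h (by simp)
            rev_sub := hrevD }
  · -- closed edge: stay
    rw [decide_eq_false hopen]
    simp only [Bool.false_eq_true, if_false]
    exact
      { last := hlast'
        nodup := hnodup'
        chain := chain_mono hchain'
        stack_vis := fun x hx => hσ.stack_vis x (hsub x hx)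
        saturated := fun x hx hx' => sat_mono x (hsat' x hx hx')
        closed := fun e' he' he'K w hw => by
          rw [Finset.mem_insert] at he'
          rcases he' with rfl | he'
          · exact absurd he'K hopen
          · exact hσ.closed e' he' he'K w hw
        targets := fun _ => htar
        tip := fun h => absurd h (by simp)
        rev_sub := hrevD }

/-- **The final state satisfies the invariant.** [cite: Gladkov2024, §6.2] -/
theorem inv_final (hbc : b ≠ c) : ∀ (n : ℕ) {σ : St V}, Inv D a b c K σ →
    Inv D a b c K (final D b c K n σ)
  | 0, _, h => h
  | n + 1, σ, h => by
      simp only [final]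
      cases hn : next D σ with
      | none => exact h
      | some e => exact inv_final hbc n (inv_update hbc h hn)

/-- With enough fuel the exploration halts: `next (final) = none` as soon as the fuel exceeds
the number of unrevealed edges of `D`. [folklore] -/
theorem next_final_eq_none (K : Finset (Sym2 V)) : ∀ (n : ℕ) (σ : St V),
    (D \ σ.rev).card < n → next D (final D b c K n σ) = none
  | 0, _, h => absurd h (Nat.not_lt_zero _)
  | n + 1, σ, h => by
      simp only [final]
      cases hn : next D σ with
      | none => exact hn
      | some e =>
          simp only
          refine next_final_eq_none K n _ ?_
          obtain ⟨-, v, rest, -, hev⟩ := next_eq_some hn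
          rw [mem_pending] at hev
          have hmem : e ∈ D \ σ.rev := Finset.mem_sdiff.2 ⟨hev.1, hev.2.1⟩
          have hpos : 0 < (D \ σ.rev).card := Finset.card_pos.2 ⟨e, hmem⟩
          rw [rev_update, Finset.sdiff_insert, Finset.card_erase_of_mem hmem]
          omega


/-! ### Consequences at the final state -/

/-- If the exploration halts without reaching a target, every visited vertex is saturated.
[cite: Gladkov2024, §6.2] -/
theorem pending_eq_empty_of_next_eq_none {σ : St V} (hσ : Inv D a b c K σ)
    (h : next D σ = none) (hd : σ.done = false) : ∀ v ∈ σ.vis, pending D σ.rev v = ∅ := by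
  intro v hv
  rcases next_eq_none h with h' | h'
  · rw [hd] at h'; exact absurd h' (by simp)
  · by_cases hvs : v ∈ σ.stack
    · exact pending_eq_empty_of_not_mem_settle σ.rev hvs (by rw [h']; simp)
    · exact hσ.saturated v hv hvs

/-- The root is on the stack. [folklore] -/
theorem Inv.root_mem_stack {σ : St V} (hσ : Inv D a b c K σ) : a ∈ σ.stack := by
  obtain ⟨ys, hys⟩ := List.getLast?_eq_some_iff.1 hσ.last
  rw [hys]; simp

/-- When every visited vertex is saturated, the `K`-open cluster of the root is visited
(`K ⊆ D`). [cite: Gladkov2024, §6.2] -/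
theorem Inv.mem_vis_of_reachable {σ : St V} (hσ : Inv D a b c K σ)
    (hsat : ∀ v ∈ σ.vis, pending D σ.rev v = ∅) (hKD : K ⊆ D) {y : V}
    (h : (openGraph (↑K : Set (Sym2 V))).Reachable a y) : y ∈ σ.vis := by
  obtain ⟨W⟩ := h
  suffices H : ∀ {x y : V} (_ : (openGraph (↑K : Set (Sym2 V))).Walk x y), x ∈ σ.vis → y ∈ σ.vis
    from H W (hσ.stack_vis a hσ.root_mem_stack)
  intro x y W
  induction W with
  | nil => exact id
  | @cons x w y hadj W ih =>
      intro hx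
      rw [openGraph_adj] at hadj
      obtain ⟨hxw, hne⟩ := hadj
      have hxwK : s(x, w) ∈ K := hxw
      have hrev : s(x, w) ∈ σ.rev := by
        by_contra hr
        have : s(x, w) ∈ pending D σ.rev x := mem_pending.2 ⟨hKD hxwK, hr, Sym2.mem_mk_left x w⟩
        rw [hsat x hx] at this
        simp at this
      exact ih (hσ.closed _ hrev hxwK w (Sym2.mem_mk_right x w))

/-- **`abc ⊆ R_b ∪ R_c`**: if the root is joined to a target by `K`-open edges (`K ⊆ D`), the
halted exploration has stopped at a target. [cite: Gladkov2024, §6.2] -/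
theorem Inv.done_of_reachable {σ : St V} (hσ : Inv D a b c K σ) (hnext : next D σ = none)
    (hKD : K ⊆ D) {t : V} (ht : t = b ∨ t = c)
    (h : (openGraph (↑K : Set (Sym2 V))).Reachable a t) : σ.done = true := by
  by_contra hd
  have hd' : σ.done = false := by simpa using hd
  have htvis := hσ.mem_vis_of_reachable (pending_eq_empty_of_next_eq_none hσ hnext hd') hKD h
  rcases ht with rfl | rfl
  · exact (hσ.targets hd').1 htvis
  · exact (hσ.targets hd').2 htvis

omit [DecidableEq V] in
/-- All vertices of a chain of adjacent vertices are joined. [folklore] -/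
theorem reachable_of_isChain {H : SimpleGraph V} {L : List V}
    (h : List.IsChain (fun u v => H.Adj u v) L) : ∀ x ∈ L, ∀ y ∈ L, H.Reachable x y := by
  induction h with
  | nil => intro x hx; simp at hx
  | singleton a =>
      intro x hx y hy
      rw [List.mem_singleton] at hx hy
      rw [hx, hy]
  | @cons_cons u w l huw _ ih =>
      have key : ∀ x ∈ u :: w :: l, H.Reachable x w := by
        intro x hx
        rcases List.mem_cons.1 hx with rfl | hx
        · exact huw.reachable
        · exact ih x hx w (List.mem_cons_self ..)
      intro x hx y hy
      exact (key x hx).trans (key y hy).symm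

/-- The stack is a chain of the open graph of any configuration containing its open revealed
edges. [folklore] -/
theorem Inv.isChain_adj {σ : St V} (hσ : Inv D a b c K σ) {I : Finset (Sym2 V)}
    {L : List V} (hL : L <:+: σ.stack)
    (hI : ∀ u ∈ L, ∀ v ∈ L, u ≠ v → s(u, v) ∈ σ.rev → s(u, v) ∈ K → s(u, v) ∈ I) :
    List.IsChain (fun u v => (openGraph (↑I : Set (Sym2 V))).Adj u v) L := by
  have h := List.IsChain.infix hσ.chain hL
  refine List.IsChain.imp_of_mem_imp (fun u v hu hv huv => ?_) h
  rw [openGraph_adj]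
  exact ⟨hI u hu v hv huv.1 huv.2.1 huv.2.2, huv.1⟩

/-- **`R_t ⊆ {a ↔ t}`**: after stopping, the root is joined to the target on top of the stack
by open revealed edges. [cite: Gladkov2024, §6.2] -/
theorem Inv.reachable_of_done {σ : St V} (hσ : Inv D a b c K σ) (hd : σ.done = true) :
    ∃ t rest, σ.stack = t :: rest ∧ (t = b ∨ t = c) ∧
      (openGraph (↑K : Set (Sym2 V))).Reachable a t := by
  obtain ⟨t, rest, hst, ht, -, -⟩ := hσ.tip hd
  refine ⟨t, rest, hst, ht, ?_⟩
  have hch := hσ.isChain_adj (I := K) (List.infix_refl σ.stack) fun u _ v _ _ _ h => h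
  exact reachable_of_isChain hch a hσ.root_mem_stack t (by rw [hst]; exact List.mem_cons_self ..)

/-- **Entry on the stack** (the geometric heart of §6.2: "the first time this path intersects
with `P` … all the edges before this point belong to `S̄`"): for a configuration `ω ⊆ D` that
agrees with `K` on the revealed edges, an `ω`-open path from an unvisited vertex `x` to a
visited vertex has an initial segment made of UNREVEALED `ω`-open edges and ending at a vertex
of the stack. (Vertices visited but off the stack are saturated, so they cannot be entered by an
unrevealed edge; a revealed open edge has both endpoints visited.) [cite: Gladkov2024, §6.2 (P, Q) and §6.1 (16)] -/
theorem Inv.exists_entry {σ : St V} (hσ : Inv D a b c K σ) {ω : Finset (Sym2 V)} (hωD : ω ⊆ D)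
    (hagree : ∀ e ∈ σ.rev, (e ∈ ω ↔ e ∈ K)) {x y : V} (hx : x ∉ σ.vis) (hy : y ∈ σ.vis)
    (h : (openGraph (↑ω : Set (Sym2 V))).Reachable x y) :
    ∃ z ∈ σ.stack, (openGraph (↑(ω \ σ.rev) : Set (Sym2 V))).Reachable x z := by
  obtain ⟨W⟩ := h
  obtain ⟨z, hz, P, hP⟩ := exists_walk_firstHit (T := (↑σ.vis : Set V)) W hy
  have hz' : z ∈ σ.vis := hz
  have hedges : ∀ e ∈ P.edges, e ∈ (↑(ω \ σ.rev) : Set (Sym2 V)) := by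
    intro e he
    have heω : e ∈ ω := mem_of_mem_walk_edges P he
    rw [Finset.coe_sdiff]
    refine ⟨heω, fun herev => ?_⟩
    have heK : e ∈ K := (hagree e herev).1 heω
    have hdiag : e.IsDiag := sym2_isDiag_of_forall_eq fun w hw =>
      hP w (SimpleGraph.Walk.mem_support_of_mem_edges he hw) (hσ.closed e herev heK w hw)
    exact (openGraph (↑ω : Set (Sym2 V))).not_isDiag_of_mem_edgeSet (P.edges_subset_edgeSet he)
      hdiag
  refine ⟨z, ?_, reachable_openGraph_of_walk P hedges⟩
  have hnil : ¬ P.Nil := fun hn => hx (hn.eq ▸ hz')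
  obtain ⟨e, he, hze⟩ :=
    (SimpleGraph.Walk.mem_support_iff_exists_mem_edges_of_not_nil hnil).1 P.end_mem_support
  have he' := hedges e he
  rw [Finset.coe_sdiff] at he'
  have hpend : e ∈ pending D σ.rev z := mem_pending.2 ⟨hωD he'.1, he'.2, hze⟩
  by_contra hzs
  rw [hσ.saturated z hz' hzs] at hpend
  simp at hpend

end Invariant

end Gladkov

end Literature.Probability.Percolation
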